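import Summits.CriticalPhenomena.PercolationContinuityZ3.Theorems.TallClusterMassBound.Negative.MassExponentFamily
import Literature.Probability.Percolation.InequalitiesProofs

/-!
# `TallClusterMassBound` (stmt-CriticalPhenomena-0912) — criticality is load-bearing; no uniform density; asymptotic form

Negative-side theorems for the crux `…Theses.PercLowPointHalfSpace.TallClusterMassBound`, continuing
`Negative/MassExponentFamily.lean`; extracted from `Cruxes/TallClusterMassBound/Disproof.lean` §3–§7.

* §3 `not_massBoundAt_of_dense` : `UniformlyDense p c`, `c > 0` ⇒ `¬ MassBoundAt p s` for all `s < 3` ('dense wall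
  clusters ⇒ m = 3'); the instance `p = 1` is proved (`uniformlyDense_one`: all half-box edges open a.s.), giving
  `tallClusterMassBound_false_without_criticality` : `¬ MassBoundAt 1 (11/4)` — any proof of the crux must use
  `p ≤ p_c` quantitatively.
* §4 `not_densityBoundAt_criticalProbI` : the UNIFORM density strengthening `P(0 ↔_ℍ x ∧ arm) ≤ C r^{s-3} π` (all
  `x ∈ B_r`) is false at `p_c` for every `s < 3` (test `x = 0`); `DensityBoundAt.massBoundAt` (uniform ⇒ crux shape).
* §4b `chiH_mul_armProb_le_mass` (Harris–FKG: `χ_ℍ^{(r)} π ≤ M`), `chiH_criticalProbI_le_of_tallClusterMassBound`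
  (the crux contains the still-open sub-volume bound `E_{p_c}|C_ℍ(0) ∩ B_r| ≤ C r^{11/4}`), `density_ge_tau`.
* §6 `massBoundAt_of_eventually`, `tallClusterMassBound_iff_eventually` : the crux is equivalent to its eventual
  form (no finite range of `r` can refute it). (§5 `p = 0` and §7 summary stay in the work file.)
-/

noncomputable section

open MeasureTheory ProbabilityTheory Filter
open Literature.Probability.Percolation Literature.Probability.LatticeModels
open Summit.CriticalPhenomena.PercolationContinuityZ3.Theses.PercLowPointHalfSpace (TallClusterMassBound)

namespace Summit.CriticalPhenomena.PercolationContinuityZ3.Theorems.TallClusterMassBound.Negative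

/-! ## §3 LOAD-BEARING: criticality from ABOVE. Dense half-space clusters force `m = 3`;
at `p = 1` (and, modulo half-space uniqueness + FKG, at every `p > p_c`) `MassBoundAt p s` fails for all `s < 3` -/

/-- The cube `{0,…,r}³ ⊆ B_r ∩ ℍ`. [folklore] -/
def cube (r : ℕ) : Finset V3 := Fintype.piFinset fun _ : Fin 3 => Finset.Icc (0 : ℤ) r

/-- The half-box `B_r ∩ ℍ`. [folklore] -/
def halfBox (r : ℕ) : Finset V3 := (box 3 r).filter fun x => 0 ≤ x 0

/-- `|cube r| = (r+1)³`. [folklore] -/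
theorem card_cube (r : ℕ) : (cube r).card = (r + 1) ^ 3 := by
  have h : ((r : ℤ) + 1 - 0).toNat = r + 1 := by omega
  rw [cube, Fintype.card_piFinset_const, Int.card_Icc, h]

/-- `cube r ⊆ B_r ∩ ℍ`. [folklore] -/
theorem cube_subset_halfBox (r : ℕ) : cube r ⊆ halfBox r := by
  intro x hx
  rw [cube, Fintype.mem_piFinset] at hx
  rw [halfBox, Finset.mem_filter, mem_box]
  exact ⟨fun i => by have := Finset.mem_Icc.1 (hx i); omega, (Finset.mem_Icc.1 (hx 0)).1⟩

/-- `B_r ∩ ℍ ⊆ B_r`. [folklore] -/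
theorem halfBox_subset_box (r : ℕ) : halfBox r ⊆ box 3 r := Finset.filter_subset _ _

/-- `cube r ⊆ B_r`. [folklore] -/
theorem cube_subset_box (r : ℕ) : cube r ⊆ box 3 r := (cube_subset_halfBox r).trans (halfBox_subset_box r)

/-- `up k ∈ cube r` for `k ≤ r`. [folklore] -/
theorem up_mem_cube {k r : ℕ} (hk : k ≤ r) : up k ∈ cube r := by
  rw [cube, Fintype.mem_piFinset, forall_fin3]
  simp only [up, Finset.mem_Icc]
  exact ⟨by simpa using hk, by simp, by simp⟩

/-- `UniformlyDense p c`: every vertex of the cube `{0,…,r}³` is joined to `0` in `ℍ` by a cluster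
reaching sup-distance `r`, with probability at least `c`, uniformly in `r ≥ 1`. For `p > p_c(ℤ³)` this
holds with `c = θ_ℍ(p)² > 0` by Grimmett–Marstrand (`p_c(ℍ) = p_c`, tree fact
`GrimmettMarstrand1990_halfSpace`), Harris–FKG and uniqueness of the infinite `ℍ`-cluster — standard,
not formalised here; at `p = 1` it holds with `c = 1` (`uniformlyDense_one`, proved). In a hypothetical
jump world it FAILS at `p_c` itself (BGN: `θ_ℍ(p_c) = 0` unconditionally), which is why §3 does not
refute the crux. [folklore] -/
def UniformlyDense (p : unitInterval) (c : ℝ) : Prop :=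
  ∀ r : ℕ, 1 ≤ r → ∀ x ∈ cube r, c ≤ (Pp p).real (conn x ∩ arm r)

/-- Under `UniformlyDense p c`: `c (r+1)³ ≤ M_p(r)`. [folklore] -/
theorem mass_ge_of_dense {p : unitInterval} {c : ℝ} (h : UniformlyDense p c) {r : ℕ} (hr : 1 ≤ r) :
    c * ((r : ℝ) + 1) ^ 3 ≤ mass p r := by
  unfold mass
  calc c * ((r : ℝ) + 1) ^ 3 = ∑ _x ∈ cube r, c := by
        rw [Finset.sum_const, nsmul_eq_mul, card_cube]; push_cast; ring
    _ ≤ ∑ x ∈ cube r, (Pp p).real (conn x ∩ arm r) := Finset.sum_le_sum fun x hx => h r hr x hx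
    _ ≤ ∑ x ∈ box 3 r, (Pp p).real (conn x ∩ arm r) :=
        Finset.sum_le_sum_of_subset_of_nonneg (cube_subset_box r) fun _ _ _ => measureReal_nonneg

/-- DENSE ⇒ `m = 3`: under `UniformlyDense p c`, `c > 0`, the bound `MassBoundAt p s` fails for every
`s < 3`. This is the formal content of "a jump world has finite but DENSE half-space clusters, `m = 3`"
— except that density in this uniform sense is exactly what BGN denies AT `p_c`. [folklore] -/
theorem not_massBoundAt_of_dense {p : unitInterval} {c : ℝ} (hc : 0 < c) (h : UniformlyDense p c)
    {s : ℝ} (hs : s < 3) : ¬ MassBoundAt p s := by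
  rintro ⟨C, hC⟩
  refine not_forall_rpow_le (c := c) (C := |C|) hc hs fun r hr => ?_
  have h1 := mass_ge_of_dense h hr
  have h2 := hC r hr
  have hπ := armProb_le_one p r
  have hπ0 := armProb_nonneg p r
  have hr0 : (0 : ℝ) ≤ r := by positivity
  have hrs : 0 ≤ (r : ℝ) ^ s := Real.rpow_nonneg hr0 s
  have h3 : (r : ℝ) ^ (3 : ℝ) = (r : ℝ) ^ (3 : ℕ) := by exact_mod_cast Real.rpow_natCast (r : ℝ) 3
  have h4a : C * (r : ℝ) ^ s * armProb p r ≤ |C| * (r : ℝ) ^ s * armProb p r :=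
    mul_le_mul_of_nonneg_right (mul_le_mul_of_nonneg_right (le_abs_self C) hrs) hπ0
  have h4b : |C| * (r : ℝ) ^ s * armProb p r ≤ |C| * (r : ℝ) ^ s := by
    have := mul_le_mul_of_nonneg_left hπ (mul_nonneg (abs_nonneg C) hrs)
    simpa using this
  have h5 : c * (r : ℝ) ^ (3 : ℕ) ≤ c * ((r : ℝ) + 1) ^ 3 := by gcongr; linarith
  rw [h3]
  linarith

/-! ### The instance `p = 1`: all lattice edges are open a.s., `UniformlyDense 1 1` -/

/-- The lattice edges with both endpoints in the half-box. [folklore] -/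
def boxEdges (r : ℕ) : Finset (Sym2 V3) :=
  ((halfBox r ×ˢ halfBox r).filter fun e => (zdGraph 3).Adj e.1 e.2).image fun e => s(e.1, e.2)

/-- `boxEdges r` consists of lattice edges. [folklore] -/
theorem boxEdges_subset_edgeSet (r : ℕ) : (↑(boxEdges r) : Set (Sym2 V3)) ⊆ (zdGraph 3).edgeSet := by
  intro e he
  rw [Finset.mem_coe, boxEdges, Finset.mem_image] at he
  obtain ⟨e, he, rfl⟩ := he
  exact (SimpleGraph.mem_edgeSet _).2 (Finset.mem_filter.1 he).2

/-- If all half-box edges are open, lattice neighbours in the half-box are joined by an open step inside `ℍ`. [folklore] -/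
theorem adj_of_boxEdges {ω : BondConfig V3} {r : ℕ} (hω : (↑(boxEdges r) : Set (Sym2 V3)) ⊆ ω)
    {x x' : V3} (hx : x ∈ halfBox r) (hx' : x' ∈ halfBox r) (h : (zdGraph 3).Adj x x') :
    (openGraph ω ⊓ withinGraph ⊤ Hs).Adj x x' := by
  have he : s(x, x') ∈ ω := hω (by
    rw [Finset.mem_coe, boxEdges, Finset.mem_image]
    exact ⟨(x, x'), Finset.mem_filter.2 ⟨Finset.mem_product.2 ⟨hx, hx'⟩, h⟩, rfl⟩)
  rw [SimpleGraph.inf_adj, openGraph_adj, withinGraph_adj, SimpleGraph.top_adj]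
  exact ⟨⟨he, h.ne⟩, h.ne, (Finset.mem_filter.1 hx).2, (Finset.mem_filter.1 hx').2⟩

/-- If every lattice edge of the half-box is open, every vertex of the half-box is joined to `0` inside
`ℍ` (move one coordinate towards `0` at a time; the half-box is invariant under these moves).
[folklore] -/
theorem reachable_zero_of_boxEdges {ω : BondConfig V3} {r : ℕ} (hω : (↑(boxEdges r) : Set (Sym2 V3)) ⊆ ω)
    {x : V3} (hx : x ∈ halfBox r) : (openGraph ω ⊓ withinGraph ⊤ Hs).Reachable x 0 := by
  suffices H : ∀ m : ℕ, ∀ x : V3, x ∈ halfBox r → ∑ i, (x i).natAbs = m →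
      (openGraph ω ⊓ withinGraph ⊤ Hs).Reachable x 0 from H _ x hx rfl
  intro m
  induction m using Nat.strong_induction_on with
  | _ m ih =>
    intro x hx hm
    by_cases h0 : x = 0
    · subst h0; rfl
    · obtain ⟨i, hi⟩ : ∃ i, x i ≠ 0 := by
        by_contra h
        push Not at h
        exact h0 (funext h)
      have hxbox : ∀ j, -(r : ℤ) ≤ x j ∧ x j ≤ r := mem_box.1 (Finset.mem_filter.1 hx).1
      have hx0 : 0 ≤ x 0 := (Finset.mem_filter.1 hx).2
      set v : ℤ := if 0 < x i then x i - 1 else x i + 1 with hv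
      set x' : V3 := Function.update x i v with hx'
      have hx'j : ∀ j, j ≠ i → x' j = x j := fun j hj => by simp [hx', hj]
      have hx'i : x' i = v := by simp [hx']
      have hx'half : x' ∈ halfBox r := by
        rw [halfBox, Finset.mem_filter, mem_box]
        refine ⟨fun j => ?_, ?_⟩
        · rcases eq_or_ne j i with rfl | hj
          · rw [hx'i, hv]; have := hxbox j; split_ifs <;> omega
          · rw [hx'j j hj]; exact hxbox j
        · rcases eq_or_ne (0 : Fin 3) i with h0i | h0i
          · subst h0i; rw [hx'i, hv]; split_ifs <;> omega
          · rw [hx'j 0 h0i]; exact hx0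
      have hadj : (zdGraph 3).Adj x x' := by
        rw [zdGraph_adj_iff]
        refine ⟨i, ?_⟩
        by_cases hpos : 0 < x i
        · right
          funext j
          rcases eq_or_ne j i with rfl | hj
          · simp [hx'i, hv, hpos]
          · simp [hx'j j hj, hj]
        · left
          funext j
          rcases eq_or_ne j i with rfl | hj
          · simp [hx'i, hv, hpos]
          · simp [hx'j j hj, hj]
      have hlt : ∑ j, (x' j).natAbs < m := by
        rw [← hm]
        apply Finset.sum_lt_sum
        · intro j _
          rcases eq_or_ne j i with rfl | hj
          · rw [hx'i, hv]; split_ifs <;> omega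
          · rw [hx'j j hj]
        · refine ⟨i, Finset.mem_univ _, ?_⟩
          rw [hx'i, hv]; split_ifs <;> omega
      exact (adj_of_boxEdges hω hx hx'half hadj).reachable.trans (ih _ hlt x' hx'half rfl)

/-- If all half-box edges are open, every half-box vertex is joined to `0` in `ℍ`. [folklore] -/
theorem conn_of_boxEdges {ω : BondConfig V3} {r : ℕ} (hω : (↑(boxEdges r) : Set (Sym2 V3)) ⊆ ω)
    {x : V3} (hx : x ∈ halfBox r) : ω ∈ conn x :=
  mem_conn_iff.2 (reachable_zero_of_boxEdges hω hx).symm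

/-- If all half-box edges are open, `arm_ℍ(0,r)` holds (witness `up r`). [folklore] -/
theorem arm_of_boxEdges {ω : BondConfig V3} {r : ℕ} (hω : (↑(boxEdges r) : Set (Sym2 V3)) ⊆ ω) :
    ω ∈ arm r :=
  mem_arm_iff.2 ⟨up r, by simp [snorm, up],
    (reachable_zero_of_boxEdges hω (cube_subset_halfBox r (up_mem_cube le_rfl))).symm⟩

/-- At `p = 1`: `P_1(0 ↔_ℍ x, arm_ℍ(0,r)) = 1` for every `x ∈ B_r ∩ ℍ`. [folklore] -/
theorem real_conn_inter_arm_one {r : ℕ} {x : V3} (hx : x ∈ halfBox r) :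
    (Pp 1).real (conn x ∩ arm r) = 1 := by
  apply le_antisymm measureReal_le_one
  have h := bondPercolation_real_setOf_subset (zdGraph 3) 1 (boxEdges r) (boxEdges_subset_edgeSet r)
  rw [Set.Icc.coe_one, one_pow] at h
  calc (1 : ℝ) = (Pp 1).real {ω | ↑(boxEdges r) ⊆ ω} := by rw [Pp, h]
    _ ≤ _ := measureReal_mono (show {ω : BondConfig V3 | ↑(boxEdges r) ⊆ ω} ⊆ conn x ∩ arm r from
        fun ω hω => ⟨conn_of_boxEdges hω hx, arm_of_boxEdges hω⟩)

/-- At `p = 1` the family is uniformly dense with `c = 1`. [folklore] -/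
theorem uniformlyDense_one : UniformlyDense 1 1 := fun r _ _ hx =>
  (real_conn_inter_arm_one (cube_subset_halfBox r hx)).ge

/-- LOAD-BEARING THEOREM (any proof must use `p ≤ p_c`, quantitatively): the crux's inequality with
`p_c` replaced by `p = 1` is FALSE for every exponent `s < 3`, in particular for `s = 11/4`:
`M_1(r) ≥ (r+1)³` while `π_1(r) = 1`. [folklore] -/
theorem not_massBoundAt_one {s : ℝ} (hs : s < 3) : ¬ MassBoundAt 1 s :=
  not_massBoundAt_of_dense one_pos uniformlyDense_one hs

/-- The crux's shape `TallClusterMassBoundAt p := MassBoundAt p (11/4)` is false at `p = 1`. [folklore] -/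
theorem tallClusterMassBound_false_without_criticality : ¬ MassBoundAt 1 ((11 : ℝ) / 4) :=
  not_massBoundAt_one (by norm_num)

/-! ## §4 NATURAL STRENGTHENING REFUTED: no UNIFORM density bound. The conditional density
`ρ_r(x) = P(0 ↔_ℍ x | arm_ℍ(0,r))` is `≡ 1` at the root, so `ρ_r(x) ≤ C r^{s-3}` uniformly in `x ∈ B_r`
fails for every `s < 3` and every `p > 0`; the crux is an AVERAGED statement (decay of `ρ_r` in `|x|`). -/

/-- Uniform (pointwise-in-`x`) density version of the crux. [folklore] -/
def DensityBoundAt (p : unitInterval) (s : ℝ) : Prop :=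
  ∃ C : ℝ, ∀ r : ℕ, 1 ≤ r → ∀ x ∈ box 3 r,
    (Pp p).real (conn x ∩ arm r) ≤ C * (r : ℝ) ^ (s - 3) * armProb p r

/-- The uniform density bound implies the crux's shape (sum over `|B_r| ≤ 27 r³` terms). [folklore] -/
theorem DensityBoundAt.massBoundAt {p : unitInterval} {s : ℝ} (h : DensityBoundAt p s) :
    MassBoundAt p s := by
  obtain ⟨C, hC⟩ := h
  refine ⟨27 * max C 0, fun r hr => ?_⟩
  have hr' : (1 : ℝ) ≤ r := by exact_mod_cast hr
  have hr0 : (0 : ℝ) < r := by linarith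
  have hπ0 := armProb_nonneg p r
  have hrs : 0 ≤ (r : ℝ) ^ (s - 3) := Real.rpow_nonneg hr0.le _
  have h27 : (2 * (r : ℝ) + 1) ^ 3 ≤ 27 * (r : ℝ) ^ (3 : ℕ) := by
    have : (2 * (r : ℝ) + 1) ^ 3 ≤ (3 * (r : ℝ)) ^ 3 :=
      pow_le_pow_left₀ (by linarith) (by linarith) 3
    linarith [show (3 * (r : ℝ)) ^ 3 = 27 * (r : ℝ) ^ 3 by ring]
  have hsplit : (r : ℝ) ^ s = (r : ℝ) ^ (3 : ℕ) * (r : ℝ) ^ (s - 3) := by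
    have h3 : (r : ℝ) ^ (3 : ℝ) = (r : ℝ) ^ (3 : ℕ) := by exact_mod_cast Real.rpow_natCast (r : ℝ) 3
    rw [← h3, ← Real.rpow_add hr0]; ring_nf
  have hK : 0 ≤ max C 0 * (r : ℝ) ^ (s - 3) * armProb p r :=
    mul_nonneg (mul_nonneg (le_max_right _ _) hrs) hπ0
  calc mass p r ≤ ∑ _x ∈ box 3 r, max C 0 * (r : ℝ) ^ (s - 3) * armProb p r := by
        unfold mass
        refine Finset.sum_le_sum fun x hx => (hC r hr x hx).trans ?_
        exact mul_le_mul_of_nonneg_right (mul_le_mul_of_nonneg_right (le_max_left _ _) hrs) hπ0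
    _ = (2 * (r : ℝ) + 1) ^ 3 * (max C 0 * (r : ℝ) ^ (s - 3) * armProb p r) := by
        rw [Finset.sum_const, nsmul_eq_mul, card_box]; push_cast; ring
    _ ≤ 27 * (r : ℝ) ^ (3 : ℕ) * (max C 0 * (r : ℝ) ^ (s - 3) * armProb p r) :=
        mul_le_mul_of_nonneg_right h27 hK
    _ = 27 * max C 0 * (r : ℝ) ^ s * armProb p r := by rw [hsplit]; ring

/-- `{0 ↔_ℍ 0}` is the sure event. [folklore] -/
theorem conn_zero : conn 0 = Set.univ := by
  ext ω
  simp only [Set.mem_univ, iff_true]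
  rw [mem_conn_iff]

/-- The uniform density bound is FALSE for every `s < 3` whenever the arm probabilities are positive:
test it at the root `x = 0`, where `P(0 ↔_ℍ 0, arm) = P(arm)`. [folklore] -/
theorem not_densityBoundAt {p : unitInterval} (hπ : ∀ r : ℕ, 1 ≤ r → 0 < armProb p r) {s : ℝ}
    (hs : s < 3) : ¬ DensityBoundAt p s := by
  rintro ⟨C, hC⟩
  refine not_forall_rpow_le (c := 1) (C := C) (s := s - 3) (t := 0) one_pos (by linarith) fun r hr => ?_
  have h := hC r hr 0 (zero_mem_box 3 r)
  rw [conn_zero, Set.univ_inter] at h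
  have h' : (1 : ℝ) ≤ C * (r : ℝ) ^ (s - 3) := le_of_mul_le_mul_right (by rw [one_mul]; exact h) (hπ r hr)
  rw [Real.rpow_zero]; linarith

/-- At `p_c(ℤ³)`: no uniform density bound with any `s < 3` (in particular not with `s = 11/4`). [folklore] -/
theorem not_densityBoundAt_criticalProbI {s : ℝ} (hs : s < 3) : ¬ DensityBoundAt (criticalProbI 3) s :=
  not_densityBoundAt (fun r _ => armProb_criticalProbI_pos r) hs

/-! ## §4b POSITIVE ASSOCIATION: `M_p(r) ≥ π_p(r) · E_p|C_ℍ(0) ∩ B_r|`. Hence B contains the (still OPEN) sub-volume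
bound `E_{p_c}|C_ℍ(0) ∩ B_r| ≤ C r^{11/4}` for the UNCONDITIONAL truncated half-space susceptibility (BGN gives only
`o(r³)`, no rate), and the conditional density at any FIXED vertex never decays: `ρ_r(x) ≥ τ_ℍ(0,x)`. -/

/-- `{0 ↔_ℍ x}` is increasing. [folklore] -/
theorem isUpperSet_conn (x : V3) : IsUpperSet (conn x) := by
  rw [conn, openConnIn_eq_openConnVia zero_mem_Hs]
  exact isUpperSet_openConnVia _ _ _

/-- `arm_ℍ(0,r)` is increasing. [folklore] -/
theorem isUpperSet_arm (r : ℕ) : IsUpperSet (arm r) := by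
  have : arm r = ⋃ y : V3, ⋃ (_ : ∃ i : Fin 3, (r : ℤ) ≤ |y i|), openConnIn Hs 0 y := by
    ext ω; simp [arm]
  rw [this]
  refine isUpperSet_iUnion fun y => isUpperSet_iUnion fun _ => ?_
  rw [openConnIn_eq_openConnVia zero_mem_Hs]
  exact isUpperSet_openConnVia _ _ _

/-- Harris–FKG: `P_p(0 ↔_ℍ x) · π_p(r) ≤ P_p(0 ↔_ℍ x ∧ arm_r)` — conditioning on the cluster being tall only
increases the probability that it contains `x`. [folklore] -/
theorem real_conn_mul_armProb_le (p : unitInterval) (x : V3) (r : ℕ) :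
    (Pp p).real (conn x) * armProb p r ≤ (Pp p).real (conn x ∩ arm r) :=
  harris_fkg_holds (zdGraph 3) p (isUpperSet_conn x) (isUpperSet_arm r) (measurableSet_conn x)
    (measurableSet_arm r)

/-- The truncated half-space susceptibility `χ_ℍ^{(r)}(p) = E_p|C_ℍ(0) ∩ B_r| = Σ_{x ∈ B_r} P_p(0 ↔_ℍ x)`.
[folklore] -/
def chiH (p : unitInterval) (r : ℕ) : ℝ := ∑ x ∈ box 3 r, (Pp p).real (conn x)

/-- `χ_ℍ^{(r)}(p) · π_p(r) ≤ M_p(r)`. [folklore] -/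
theorem chiH_mul_armProb_le_mass (p : unitInterval) (r : ℕ) : chiH p r * armProb p r ≤ mass p r := by
  rw [chiH, mass, Finset.sum_mul]
  exact Finset.sum_le_sum fun x _ => real_conn_mul_armProb_le p x r

/-- B's cheaper (but still open) shadow: `MassBoundAt p s` with positive arm probabilities implies the sub-volume
bound `χ_ℍ^{(r)}(p) ≤ C r^s` on the UNCONDITIONAL truncated half-space susceptibility. At `p_c` with `s = 11/4`
this consequence is itself unproved (BGN: `τ_ℍ(0,x) ≤ π_ℍ(|x|) → θ_ℍ(p_c) = 0` gives `χ_ℍ^{(r)} = o(r³)` with no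
rate) — a candidate first target for the line, strictly weaker than B. [folklore] -/
theorem chiH_le_of_massBoundAt {p : unitInterval} {s : ℝ} (hπ : ∀ r : ℕ, 1 ≤ r → 0 < armProb p r)
    (h : MassBoundAt p s) : ∃ C : ℝ, ∀ r : ℕ, 1 ≤ r → chiH p r ≤ C * (r : ℝ) ^ s := by
  obtain ⟨C, hC⟩ := h
  refine ⟨C, fun r hr => ?_⟩
  have h1 := (chiH_mul_armProb_le_mass p r).trans (hC r hr)
  exact le_of_mul_le_mul_right h1 (hπ r hr)

/-- In particular the crux implies `χ_ℍ^{(r)}(p_c) ≤ C r^{11/4}`. [folklore] -/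
theorem chiH_criticalProbI_le_of_tallClusterMassBound (h : TallClusterMassBound) :
    ∃ C : ℝ, ∀ r : ℕ, 1 ≤ r → chiH (criticalProbI 3) r ≤ C * (r : ℝ) ^ ((11 : ℝ) / 4) :=
  chiH_le_of_massBoundAt (fun r _ => armProb_criticalProbI_pos r) (tallClusterMassBound_iff.1 h)

/-- The conditional density at a fixed vertex never decays: `ρ_r(x) · π(r) = P(0 ↔_ℍ x ∧ arm_r) ≥ τ_ℍ(0,x) π(r)`
for EVERY `r`; so all the decay B needs must come from `|x| → ∞`, none from `r → ∞` at fixed `x`. [folklore] -/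
theorem density_ge_tau (p : unitInterval) (x : V3) (r : ℕ) (hπ : 0 < armProb p r) :
    (Pp p).real (conn x) ≤ (Pp p).real (conn x ∩ arm r) / armProb p r := by
  rw [le_div_iff₀ hπ]
  exact real_conn_mul_armProb_le p x r


/-! ## §6 The crux is PURELY ASYMPTOTIC: no finite range of `r` can refute it -/

/-- Since `π_p(r) > 0`, an eventual bound (any `C`, all `r ≥ N`) upgrades to a bound for all `r ≥ 1`
(enlarge `C` by the finitely many ratios below `N`). Consequently NO finite computation — at any
precision, for any finite set of radii — can refute `TallClusterMassBound`; only the `r → ∞` exponent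
matters (and `p_c(ℤ³)` is not known in closed form anyway). [folklore] -/
theorem massBoundAt_of_eventually {p : unitInterval} {s : ℝ} (hπ : ∀ r : ℕ, 1 ≤ r → 0 < armProb p r)
    (h : ∃ C : ℝ, ∃ N : ℕ, ∀ r : ℕ, N ≤ r → mass p r ≤ C * (r : ℝ) ^ s * armProb p r) :
    MassBoundAt p s := by
  obtain ⟨C, N, hC⟩ := h
  set f : ℕ → ℝ := fun r => mass p r / ((r : ℝ) ^ s * armProb p r) with hf_def
  refine ⟨max C 0 + ∑ k ∈ Finset.range N, |f k|, fun r hr => ?_⟩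
  have hr0 : (0 : ℝ) < r := by exact_mod_cast hr
  have hden : 0 < (r : ℝ) ^ s * armProb p r := mul_pos (Real.rpow_pos_of_pos hr0 s) (hπ r hr)
  have hS : 0 ≤ ∑ k ∈ Finset.range N, |f k| := Finset.sum_nonneg fun _ _ => abs_nonneg _
  by_cases hrN : N ≤ r
  · calc mass p r ≤ C * (r : ℝ) ^ s * armProb p r := hC r hrN
      _ = C * ((r : ℝ) ^ s * armProb p r) := by ring
      _ ≤ (max C 0 + ∑ k ∈ Finset.range N, |f k|) * ((r : ℝ) ^ s * armProb p r) :=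
          mul_le_mul_of_nonneg_right ((le_max_left _ _).trans (le_add_of_nonneg_right hS)) hden.le
      _ = _ := by ring
  · have hrlt : r ∈ Finset.range N := Finset.mem_range.2 (not_le.1 hrN)
    have hf : mass p r = f r * ((r : ℝ) ^ s * armProb p r) := by
      rw [hf_def, div_mul_cancel₀ _ hden.ne']
    have hfle : f r ≤ max C 0 + ∑ k ∈ Finset.range N, |f k| :=
      (le_abs_self _).trans ((Finset.single_le_sum (fun k _ => abs_nonneg (f k)) hrlt).trans
        (le_add_of_nonneg_left (le_max_right _ _)))
    rw [hf]
    calc f r * ((r : ℝ) ^ s * armProb p r)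
        ≤ (max C 0 + ∑ k ∈ Finset.range N, |f k|) * ((r : ℝ) ^ s * armProb p r) :=
          mul_le_mul_of_nonneg_right hfle hden.le
      _ = _ := by ring

/-- The crux is equivalent to its eventual form. [folklore] -/
theorem tallClusterMassBound_iff_eventually :
    TallClusterMassBound ↔ ∃ C : ℝ, ∃ N : ℕ, ∀ r : ℕ, N ≤ r →
      mass (criticalProbI 3) r ≤ C * (r : ℝ) ^ ((11 : ℝ) / 4) * armProb (criticalProbI 3) r := by
  rw [tallClusterMassBound_iff]
  constructor
  · rintro ⟨C, hC⟩
    exact ⟨C, 1, hC⟩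
  · exact massBoundAt_of_eventually fun r _ => armProb_criticalProbI_pos r

end Summit.CriticalPhenomena.PercolationContinuityZ3.Theorems.TallClusterMassBound.Negative
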